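import Mathlib.RingTheory.RootsOfUnity.AlgebraicallyClosed
import Mathlib.FieldTheory.IsAlgClosed.Basic
import Mathlib.GroupTheory.Torsion
import Mathlib.Data.ZMod.Units
import Mathlib.Data.Rat.Lemmas
import Literature.IUT.HodgeTheaters.ConventionsTemperoids
import HarnessLib

/-!
# [IUTchI] §0 p. 33: divisible / cyclotomic pseudo-monoids — criteria for subsets of an abelian group, and the
# roots of unity of an algebraically closed field of characteristic zero (`μ(Λ) ≅ ℚ/ℤ`) (proof-only companion of
# abc-iut-L5-t1's `ConventionsTemperoids.lean`)

S. Mochizuki, *Inter-universal Teichmüller theory I*, kurims manuscript (May 2020), §0 "Monoids and Categories"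
p. 33: a pseudo-monoid `P` is *divisible* if "`M` and `ι` may be taken such that for each positive integer `n`,
every element of `M` admits an `n`-th root in `M`, and, moreover, an element `a ∈ M` lies in `ι(P)` if and only if
`aⁿ` lies in `ι(P)`", and *cyclotomic* if "`M` and `ι` may be taken such that the subgroup `μ_M ⊆ M` of torsion
elements of `M` is isomorphic to the group `ℚ/ℤ`, `μ_M ⊆ ι(P)`, and `μ_M·ι(P) ⊆ ι(P)`" ([IUTchI] §0 p.33)
[cite: Mochizuki2012, §0 p.33].  These adjectives are used for the pseudo-monoids of `∞κ`- and `∞κ×`-coric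
rational functions (Rmk 3.1.7 (ii) p. 68, companion file `KappaCoricPseudoMonoidsProofs.lean`) and for the
monoids `𝒪^▷`, `𝒪^×·μ` of [IUTchI] Ex 5.1 / Def 5.2 (v)–(viii).  Everything here is elementary group / field
theory; nothing of the series' disputed content is involved and no side is taken on [IUTchIII] Cor. 3.12.

* `nonempty_torsion_mulEquiv_qModZ` — **for an algebraically closed field `Λ` of characteristic zero, the
  torsion subgroup of `Λˣ` (the roots of unity) is isomorphic to `ℚ/ℤ`** (abc-iut-L5-t1's `QModZ`): a
  compatible system of primitive `k!`-th roots of unity, built by lifting generators along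
  `(ℤ/kNℤ)ˣ ↠ (ℤ/Nℤ)ˣ` (Mathlib `ZMod.unitsMap_surjective`), gives `ℚ → Λˣ`, `a/d ↦ ζ_d^a`, which descends to
  an isomorphism `ℚ/ℤ ⥲ μ(Λ)`.  [folklore; not in Mathlib at the time of writing]
* `PartialMul.isDivisible_ofSubset`, `PartialMul.isCyclotomic_ofSubset` — the two §0 adjectives for a subset
  of an abelian group with the restricted multiplication (abc-iut-L5-t1's `PartialMul.ofSubset`), realised by
  the inclusion: criteria in terms of `n`-th roots / the torsion subgroup.

PROOF-ONLY: no definition, no instance, no notation.  typed ≠ proved elsewhere.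
-/

namespace Literature.IUT.HodgeTheaters

universe u v

/-! ### The roots of unity of an algebraically closed field of characteristic zero form `ℚ/ℤ` -/

/-- **`μ(Λ) ≅ ℚ/ℤ`**: for an algebraically closed field `Λ` of characteristic zero, the torsion subgroup of `Λˣ`
is isomorphic to `ℚ/ℤ` (abc-iut-L5-t1's `QModZ = Multiplicative (ℚ ⧸ ℤ·1)`, [IUTchI] §0 p. 33 "cyclotomic").
Proof: choose primitive `k!`-th roots of unity `c_k` with `c_{k+1}^{k+1} = c_k` (a generator of `μ_N` lifts to a
generator of `μ_{kN}` above it because `(ℤ/kNℤ)ˣ → (ℤ/Nℤ)ˣ` is onto), put `ζ_n := c_n^{n!/n}`, and send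
`a/d ↦ ζ_d^a`; this is a well-defined homomorphism `ℚ → Λˣ` killing exactly `ℤ`, onto the roots of unity.
Classical; recorded here because §0's "cyclotomic" asks for it. ([IUTchI] §0 p.33) [cite: Mochizuki2012, §0 p.33] -/
theorem nonempty_torsion_mulEquiv_qModZ (Λ : Type v) [Field Λ] [IsAlgClosed Λ] [CharZero Λ] :
    Nonempty (CommGroup.torsion Λˣ ≃* QModZ) := by
  classical
  -- primitive roots of unity of every order exist
  have hprim : ∀ n : ℕ, 0 < n → ∃ ζ : Λˣ, IsPrimitiveRoot ζ n := by
    intro n hn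
    haveI : NeZero (n : Λ) := ⟨Nat.cast_ne_zero.mpr hn.ne'⟩
    obtain ⟨μ, hμ⟩ := HasEnoughRootsOfUnity.exists_primitiveRoot Λ n
    refine ⟨(hμ.isUnit hn.ne').unit, ?_⟩
    rw [← IsPrimitiveRoot.coe_units_iff, IsUnit.unit_spec]
    exact hμ
  -- a primitive `N`-th root of unity has a primitive `kN`-th root of unity as a `k`-th root
  have hlift : ∀ N k : ℕ, 0 < N → 0 < k → ∀ ζ : Λˣ, IsPrimitiveRoot ζ N →
      ∃ η : Λˣ, IsPrimitiveRoot η (k * N) ∧ η ^ k = ζ := by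
    intro N k hN hk ζ hζ
    have hkN : 0 < k * N := Nat.mul_pos hk hN
    obtain ⟨g, hg⟩ := hprim (k * N) hkN
    have hgk : IsPrimitiveRoot (g ^ k) N := hg.pow hkN rfl
    haveI : NeZero N := ⟨hN.ne'⟩
    haveI : NeZero (k * N) := ⟨hkN.ne'⟩
    obtain ⟨i, -, hicop, hζi⟩ := (hgk.isPrimitiveRoot_iff' (ξ := ζ)).1 hζ
    obtain ⟨w, hw⟩ := ZMod.unitsMap_surjective (Dvd.intro_left k rfl : N ∣ k * N) (ZMod.unitOfCoprime i hicop)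
    have hjcop : (w : ZMod (k * N)).val.Coprime (k * N) := ZMod.val_coe_unit_coprime w
    have hjmod : (w : ZMod (k * N)).val ≡ i [MOD N] := by
      rw [← ZMod.natCast_eq_natCast_iff]
      have h1 := congrArg (fun u : (ZMod N)ˣ => (u : ZMod N)) hw
      simp only [ZMod.unitsMap_val, ZMod.coe_unitOfCoprime] at h1
      rw [← h1, ZMod.cast_eq_val]
    refine ⟨g ^ (w : ZMod (k * N)).val, (hg.pow_iff_coprime hkN _).2 hjcop, ?_⟩
    rw [← pow_mul, mul_comm, pow_mul, ← hζi, pow_eq_pow_iff_modEq, ← hgk.eq_orderOf]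
    exact hjmod
  -- the chain of primitive `k!`-th roots of unity
  have step : ∀ k : ℕ, ∀ ζ : Λˣ, IsPrimitiveRoot ζ k.factorial →
      ∃ η : Λˣ, IsPrimitiveRoot η (k + 1).factorial ∧ η ^ (k + 1) = ζ := by
    intro k ζ hζ
    rw [Nat.factorial_succ]
    exact hlift _ _ (Nat.factorial_pos k) (Nat.succ_pos k) ζ hζ
  choose lift hlift₁ hlift₂ using step
  let seq : (k : ℕ) → {ζ : Λˣ // IsPrimitiveRoot ζ k.factorial} := fun k =>
    Nat.rec (motive := fun k => {ζ : Λˣ // IsPrimitiveRoot ζ k.factorial})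
      ⟨1, by rw [Nat.factorial_zero]; exact IsPrimitiveRoot.one⟩
      (fun k s => ⟨lift k s.1 s.2, hlift₁ k s.1 s.2⟩) k
  have seq_succ : ∀ k, (seq (k + 1)).1 ^ (k + 1) = (seq k).1 := fun k => hlift₂ k (seq k).1 (seq k).2
  have seq_le : ∀ j k, j ≤ k → (seq k).1 ^ (k.factorial / j.factorial) = (seq j).1 := by
    intro j k hjk
    induction k, hjk using Nat.le_induction with
    | base => rw [Nat.div_self (Nat.factorial_pos j), pow_one]
    | succ k hjk ih =>
      have e : (k + 1).factorial / j.factorial = (k + 1) * (k.factorial / j.factorial) := by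
        rw [Nat.factorial_succ, Nat.mul_div_assoc _ (Nat.factorial_dvd_factorial hjk)]
      rw [e, pow_mul, seq_succ, ih]
  -- the compatible system of primitive roots of unity `ζ_n := c_n ^ (n!/n)`
  let root : ℕ → Λˣ := fun n => (seq n).1 ^ (n.factorial / n)
  have root_prim : ∀ n, 0 < n → IsPrimitiveRoot (root n) n := fun n hn =>
    (seq n).2.pow (Nat.factorial_pos n) (Nat.div_mul_cancel (Nat.dvd_factorial hn le_rfl)).symm
  have root_mul : ∀ n m, 0 < n → 0 < m → root (n * m) ^ m = root n := by
    intro n m hn hm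
    have hle : n ≤ n * m := Nat.le_mul_of_pos_right n hm
    have e1 : (n * m).factorial / (n * m) * m = (n * m).factorial / n := by
      refine Nat.eq_of_mul_eq_mul_right hn ?_
      rw [Nat.div_mul_cancel (Nat.dvd_factorial hn hle), mul_assoc, mul_comm m n,
        Nat.div_mul_cancel (Nat.dvd_factorial (Nat.mul_pos hn hm) le_rfl)]
    have e2 : (n * m).factorial / n.factorial * (n.factorial / n) = (n * m).factorial / n := by
      refine Nat.eq_of_mul_eq_mul_right hn ?_
      rw [Nat.div_mul_cancel (Nat.dvd_factorial hn hle), mul_assoc, Nat.div_mul_cancel (Nat.dvd_factorial hn le_rfl),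
        Nat.div_mul_cancel (Nat.factorial_dvd_factorial hle)]
    change ((seq (n * m)).1 ^ ((n * m).factorial / (n * m))) ^ m = (seq n).1 ^ (n.factorial / n)
    rw [← pow_mul, e1, ← seq_le n (n * m) hle, ← pow_mul, e2]
  have root_one : root 1 = 1 := by
    have h := root_prim 1 Nat.one_pos
    rwa [IsPrimitiveRoot.one_right_iff] at h
  -- the map `ℚ → Λˣ`, `q ↦ ζ_{den q} ^ {num q}`, and its value on any representation `a/d`
  let f : ℚ → Λˣ := fun q => root q.den ^ q.num
  have hW : ∀ (a : ℤ) (d : ℕ), 0 < d → f ((a : ℚ) / d) = root d ^ a := by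
    intro a d hd
    have hd' : (d : ℤ) ≠ 0 := by exact_mod_cast hd.ne'
    obtain ⟨c, hnum, hden⟩ := Rat.exists_eq_mul_div_num_and_eq_mul_div_den a hd'
    rw [Int.cast_natCast] at hnum hden
    set q : ℚ := (a : ℚ) / d with hq
    have hc : 0 < c := by
      have h1 : 0 < c * (q.den : ℤ) := by rw [← hden]; exact_mod_cast hd
      exact pos_of_mul_pos_left h1 (by positivity)
    obtain ⟨c', rfl⟩ := Int.eq_ofNat_of_zero_le hc.le
    have hc' : 0 < c' := by exact_mod_cast hc
    have hdq : d = q.den * c' := by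
      have : (d : ℤ) = ((q.den * c' : ℕ) : ℤ) := by rw [hden]; push_cast; ring
      exact_mod_cast this
    change root q.den ^ q.num = root d ^ a
    rw [hdq, hnum, ← root_mul q.den c' q.den_pos hc', ← zpow_natCast, ← zpow_mul, mul_comm]
  have f_add : ∀ p q : ℚ, f (p + q) = f p * f q := by
    intro p q
    have hp0 : (p.den : ℚ) ≠ 0 := by exact_mod_cast p.den_ne_zero
    have hq0 : (q.den : ℚ) ≠ 0 := by exact_mod_cast q.den_ne_zero
    have hD : 0 < p.den * q.den := Nat.mul_pos p.den_pos q.den_pos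
    have e0 : p + q = ((p.num * q.den + q.num * p.den : ℤ) : ℚ) / ((p.den * q.den : ℕ) : ℚ) := by
      conv_lhs => rw [← Rat.num_div_den p, ← Rat.num_div_den q]
      rw [div_add_div _ _ hp0 hq0]
      push_cast; ring
    have e1 : p = ((p.num * q.den : ℤ) : ℚ) / ((p.den * q.den : ℕ) : ℚ) := by
      conv_lhs => rw [← Rat.num_div_den p]
      rw [← mul_div_mul_right (p.num : ℚ) (p.den : ℚ) hq0]
      push_cast; ring
    have e2 : q = ((q.num * p.den : ℤ) : ℚ) / ((p.den * q.den : ℕ) : ℚ) := by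
      conv_lhs => rw [← Rat.num_div_den q]
      rw [← mul_div_mul_left (q.num : ℚ) (q.den : ℚ) hp0]
      push_cast; ring
    have h0 : f (p + q) = root (p.den * q.den) ^ (p.num * q.den + q.num * p.den : ℤ) := by
      rw [e0]; exact hW _ _ hD
    have h1 : f p = root (p.den * q.den) ^ (p.num * q.den : ℤ) := by
      conv_lhs => rw [e1]
      exact hW _ _ hD
    have h2 : f q = root (p.den * q.den) ^ (q.num * p.den : ℤ) := by
      conv_lhs => rw [e2]
      exact hW _ _ hD
    rw [h0, h1, h2, ← zpow_add]
  have f_int : ∀ z : ℤ, f z = 1 := by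
    intro z
    have := hW z 1 Nat.one_pos
    rw [Nat.cast_one, div_one] at this
    rw [this, root_one, one_zpow]
  -- descend to `ℚ/ℤ`
  let fA : ℚ →+ Additive Λˣ :=
    { toFun := fun q => Additive.ofMul (f q)
      map_zero' := by
        have := f_int 0
        rw [Int.cast_zero] at this
        rw [this]; rfl
      map_add' := fun p q => by rw [f_add]; rfl }
  have hker : AddSubgroup.zmultiples (1 : ℚ) ≤ fA.ker := by
    intro x hx
    obtain ⟨k, rfl⟩ := AddSubgroup.mem_zmultiples_iff.1 hx
    rw [AddMonoidHom.mem_ker, Int.smul_one_eq_cast]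
    change Additive.ofMul (f k) = 0
    rw [f_int]; rfl
  let FA : ℚ ⧸ AddSubgroup.zmultiples (1 : ℚ) →+ Additive Λˣ :=
    QuotientAddGroup.lift (AddSubgroup.zmultiples (1 : ℚ)) fA hker
  have FA_mk : ∀ q : ℚ, FA (QuotientAddGroup.mk q) = Additive.ofMul (f q) := fun q =>
    QuotientAddGroup.lift_mk' _ _ q
  let Fm : QModZ →* Λˣ := AddMonoidHom.toMultiplicativeLeft FA
  have Fm_mk : ∀ q : ℚ, Fm (Multiplicative.ofAdd (QuotientAddGroup.mk q)) = f q := fun q => by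
    change Additive.toMul (FA (QuotientAddGroup.mk q)) = f q
    rw [FA_mk]; rfl
  -- every element of `ℚ/ℤ` is represented
  have hrep : ∀ x : QModZ, ∃ q : ℚ, x = Multiplicative.ofAdd (QuotientAddGroup.mk q) := by
    intro x
    induction x using QuotientAddGroup.induction_on with
    | H q => exact ⟨q, rfl⟩
  -- values are roots of unity
  have hfin : ∀ x : QModZ, Fm x ∈ CommGroup.torsion Λˣ := by
    intro x
    obtain ⟨q, rfl⟩ := hrep x
    rw [Fm_mk, CommGroup.mem_torsion]
    exact ((root_prim q.den q.den_pos).isOfFinOrder q.den_ne_zero).zpow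
  let Fc : QModZ →* CommGroup.torsion Λˣ := Fm.codRestrict _ hfin
  have hinj : Function.Injective Fc := by
    rw [injective_iff_map_eq_one]
    intro x hx
    obtain ⟨q, rfl⟩ := hrep x
    have h1 : f q = 1 := by
      rw [← Fm_mk]
      exact congrArg Subtype.val hx
    have h2 : (q.den : ℤ) ∣ q.num := ((root_prim q.den q.den_pos).zpow_eq_one_iff_dvd q.num).1 h1
    have h3 : q.den = 1 :=
      Nat.Coprime.eq_one_of_dvd q.reduced.symm (Int.natCast_dvd.1 h2)
    have h4 : (q.num : ℚ) = q := by
      conv_rhs => rw [← Rat.num_div_den q, h3, Nat.cast_one, div_one]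
    rw [← h4]
    change Multiplicative.ofAdd (QuotientAddGroup.mk ((q.num : ℚ))) = Multiplicative.ofAdd 0
    congr 1
    rw [QuotientAddGroup.eq_zero_iff]
    exact AddSubgroup.mem_zmultiples_iff.2 ⟨q.num, Int.smul_one_eq_cast q.num⟩
  have hsurj : Function.Surjective Fc := by
    rintro ⟨x, hx⟩
    rw [CommGroup.mem_torsion] at hx
    have hn : 0 < orderOf x := hx.orderOf_pos
    haveI : NeZero (orderOf x) := ⟨hn.ne'⟩
    have hmem : x ∈ rootsOfUnity (orderOf x) Λ := by
      rw [mem_rootsOfUnity]; exact pow_orderOf_eq_one x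
    obtain ⟨i, -, hi⟩ := (root_prim _ hn).eq_pow_of_mem_rootsOfUnity hmem
    refine ⟨Multiplicative.ofAdd (QuotientAddGroup.mk (((i : ℤ) : ℚ) / (orderOf x : ℕ))), Subtype.ext ?_⟩
    change Fm (Multiplicative.ofAdd (QuotientAddGroup.mk (((i : ℤ) : ℚ) / (orderOf x : ℕ)))) = x
    rw [Fm_mk, hW _ _ hn, zpow_natCast, hi]
  exact ⟨(MulEquiv.ofBijective Fc ⟨hinj, hsurj⟩).symm⟩

/-! ### §0 p. 33: criteria for a subset of an abelian group with the restricted multiplication -/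

namespace PartialMul

/-- A subset `P` of an abelian group `M` in which every element has `n`-th roots for every `n ≥ 1`, such that
`a ∈ P ↔ aⁿ ∈ P`, is — with the restricted multiplication, realised by the inclusion — a DIVISIBLE pseudo-monoid
([IUTchI] §0 p. 33). ([IUTchI] §0 p.33) [cite: Mochizuki2012, §0 p.33] -/
theorem isDivisible_ofSubset {M : Type u} [CommGroup M] (P : Set M)
    (hM : ∀ n : ℕ, 0 < n → ∀ a : M, ∃ b : M, b ^ n = a)
    (hP : ∀ n : ℕ, 0 < n → ∀ a : M, a ∈ P ↔ a ^ n ∈ P) :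
    (PartialMul.ofSubset P).IsDivisible := by
  refine ⟨M, inferInstance, Subtype.val, ⟨Subtype.val_injective, ?_, fun p => rfl⟩, fun n hn => ⟨hM n hn, ?_⟩⟩
  · ext p
    simp only [PartialMul.ofSubset, Set.mem_setOf_eq, Subtype.range_coe_subtype]
  · intro a
    rw [Subtype.range_coe]
    exact hP n hn a

/-- A subset `P` of an abelian group `M` whose torsion subgroup is isomorphic to `ℚ/ℤ`, containing the torsion and
stable under multiplication by torsion elements, is — with the restricted multiplication — a CYCLOTOMIC
pseudo-monoid ([IUTchI] §0 p. 33). ([IUTchI] §0 p.33) [cite: Mochizuki2012, §0 p.33] -/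
theorem isCyclotomic_ofSubset {M : Type u} [CommGroup M] (P : Set M)
    (hQ : Nonempty (CommGroup.torsion M ≃* QModZ))
    (h₁ : (CommGroup.torsion M : Set M) ⊆ P) (h₂ : ∀ t ∈ CommGroup.torsion M, ∀ a ∈ P, t * a ∈ P) :
    (PartialMul.ofSubset P).IsCyclotomic := by
  refine ⟨M, inferInstance, Subtype.val, ⟨Subtype.val_injective, ?_, fun p => rfl⟩, hQ, ?_, ?_⟩
  · ext p
    simp only [PartialMul.ofSubset, Set.mem_setOf_eq, Subtype.range_coe_subtype]
  · rw [Subtype.range_coe]; exact h₁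
  · rw [Subtype.range_coe]; exact h₂

end PartialMul

end Literature.IUT.HodgeTheaters
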